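import Mathlib
import HarnessLib.Audit
import Summits.PneNP.PneNP.Theorems.PstarChordReadTwoChords
import Summits.PneNP.PneNP.Theorems.PstarChordReadBiLocal

/-!
# Restricted free lunch: chord-locality of a reader on a hyperplane `{x_z = κ}` (tools for the HUB two-chord theorem; memo g22 §23)

FRONTIER range-avoidance ladder, rung F-N3, ROUND 24 (cell `pnp-ideate`, prover-2 memo `g22/O1-PAIRCORE-g22.md` §20.2 / §23; typed target
`PstarCoreBoundTargets.TerminalPeelable` (p646951); restricted-model proof complexity — nothing here bears on `P` versus `NP`).

Beyond boundary slack one, two outside-gated chords `cᵢ, cⱼ` of a terminal core may share their partner: a HUB `z` with gates `(vᵢ, z)`, `(vⱼ, z)`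
(memo §20.2; also the first obstacle met by the recursion into terminal sub-cores of branch (A), §19).  The two-chord theorem
(`PstarChordReadTwoChords.false_of_two_gated`) excludes exactly this.  In a hub the direction `(mv₁ v, mv₂ v)` of a private `v` depends on `x_z`, so
the free-lunch / involution arguments of `PstarChordReadSwitch` / `PstarChordReads` must be run ON THE HYPERPLANE `{x_z = κ}` and produce
chord-locality of the RESTRICTED reader `Γ|_{z := κ}` (`PstarChordReadRestrictVar.restrict1`).  This file supplies these generic tools (no hub
hypothesis yet):

* `fail₂_of_dir10`, `fail₁_of_dir01`, `failSum_of_dir11` — at a solution with co-private `0` where the private `v` of the chord `c` has direction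
  `(1,0)` / `(0,1)` / `(1,1)`, the reader `Γ₂` / `Γ₁` / `Γ₁ ⊕ Γ₂` misses its target (flip `v`: the core stays solved, `PstarChordReadFlip.solves_update_priv`);
* `chordLocal_restrict_of_fail` — if a reader `(C, G)` (monomials in the menu) misses `b` at every solution with co-private `0` and `x_z = κ` (`z`
  outside the core), then `restrict1 C G z κ` is CHORD-LOCAL at `c` (slice lemma `PstarChordReadLemma.chordLocal_of_fail_slice` for the menu
  `avoid (G₁ ∪ G₂) z` of monomials not containing `z`, which must avoid the chord's privates, and `SliceGeneric` for it);
* `const_on_hyperplane_of_two_chordLocal` — a restricted reader chord-local at two distinct chords is constant on the hyperplane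
  (`PstarChordReadSwitch.gval_eq_false_of_two_chordLocal`);
* `gval_eq_restrict_xor` — the normal form `Γ(x) = Γ(x[z := κ]) ⊕ (x_z ⊕ κ)·mv_z(x)` (`gval_split_var`);
* `biChordLocal_of_formula` — a reader whose value is a function of the two chords' data and of `x_z` is bi-chord-local
  (endgame `PstarChordReadBiLocal.false_of_biLocal₂`).

No Assumption A.
-/

set_option linter.dupNamespace false -- `Summit.PneNP.PneNP.…`: summit = sub-problem name (D-0017 single-conjunct layout)

open Finset Literature.Computability.Complexity
open scoped symmDiff
open Summit.PneNP.PneNP.Theorems.PstarTyped (Typed)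
open Summit.PneNP.PneNP.Theorems.PstarSALevel (varSet bdry BoundaryExpanding SimpleOverlap)
open Summit.PneNP.PneNP.Theorems.PstarCentreFree (vars_mem_varSet)
open Summit.PneNP.PneNP.Theorems.PstarGapOneAll (gval)
open Summit.PneNP.PneNP.Theorems.PstarGConstraint (gval_update_of_forall_ne)
open Summit.PneNP.PneNP.Theorems.PstarGSystemFreeVar (gval_symmDiff)
open Summit.PneNP.PneNP.Theorems.PstarChordRepair (IsChord)
open Summit.PneNP.PneNP.Theorems.PstarCoreBoundTargets (Terminal)
open Summit.PneNP.PneNP.Theorems.PstarChordReadLemma (ChordLocal SliceGeneric chordLocal_of_fail_slice)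
open Summit.PneNP.PneNP.Theorems.PstarChordReadSwitch (gval_eq_false_of_two_chordLocal solves_update_of_outside)
open Summit.PneNP.PneNP.Theorems.PstarChordReadFlip (mv gval_flip mv_update_self solves_update_priv exists_slice_priv)
open Summit.PneNP.PneNP.Theorems.PstarChordReadRestrictVar (avoid avoid_subset avoid_spec mem_avoid restrict1 restrict1_snd_subset gval_restrict1
  gval_split_var)
open Summit.PneNP.PneNP.Theorems.PstarChordReadBiLocal (BiChordLocal)

namespace Summit.PneNP.PneNP.Theorems.PstarChordReadHubLocal

variable {n m : ℕ}

/-! ## Directions of a private on a slice -/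
section Dir

variable {I : LocalMap 4 n m} {r : ℕ} {y : Fin m → Bool} {J₀ : Finset (Fin m)} {w₁ w₂ : Finset (Fin n) × Finset (Fin m) × Bool}
  {c : Fin m} {v v' : Fin n}

/-- **Direction `(1,0)`**: flipping the private `v` (co-private `0`) moves `Γ₁` only — then `Γ₂` misses `b₂` at the point. -/
theorem fail₂_of_dir10 (hI : I.IsPure xorAndPred) (ht : Terminal I r y J₀ w₁ w₂) (hc : c ∈ J₀) (hch : IsChord I J₀ c)
    (hvv : (I.vars c 2 = v ∧ I.vars c 3 = v') ∨ (I.vars c 2 = v' ∧ I.vars c 3 = v)) {x : Fin n → Bool} (hx : ∀ j ∈ J₀, I.eval x j = y j)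
    (h0 : x v' = false) (h₁ : mv I w₁.1 w₁.2.1 v x = true) (h₂ : mv I w₂.1 w₂.2.1 v x = false) : gval I w₂.1 w₂.2.1 x ≠ w₂.2.2 := by
  intro hb₂
  have hx' := solves_update_priv hI hc hch hvv hx h0 (!x v)
  have e₁ := gval_flip I w₁.1 w₁.2.1 hI x v
  have e₂ := gval_flip I w₂.1 w₂.2.1 hI x v
  rw [h₁] at e₁
  rw [h₂, hb₂] at e₂
  by_cases hb₁ : gval I w₁.1 w₁.2.1 x = w₁.2.2
  · exact ht.2.2.2.2.2.2.1 ⟨x, hx, hb₁, hb₂⟩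
  · refine ht.2.2.2.2.2.2.1 ⟨_, hx', ?_, by rw [e₂]; cases w₂.2.2 <;> rfl⟩
    rw [e₁]; revert hb₁; cases gval I w₁.1 w₁.2.1 x <;> cases w₁.2.2 <;> decide

/-- **Direction `(0,1)`**: flipping `v` moves `Γ₂` only — then `Γ₁` misses `b₁`. -/
theorem fail₁_of_dir01 (hI : I.IsPure xorAndPred) (ht : Terminal I r y J₀ w₁ w₂) (hc : c ∈ J₀) (hch : IsChord I J₀ c)
    (hvv : (I.vars c 2 = v ∧ I.vars c 3 = v') ∨ (I.vars c 2 = v' ∧ I.vars c 3 = v)) {x : Fin n → Bool} (hx : ∀ j ∈ J₀, I.eval x j = y j)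
    (h0 : x v' = false) (h₁ : mv I w₁.1 w₁.2.1 v x = false) (h₂ : mv I w₂.1 w₂.2.1 v x = true) : gval I w₁.1 w₁.2.1 x ≠ w₁.2.2 := by
  intro hb₁
  have hx' := solves_update_priv hI hc hch hvv hx h0 (!x v)
  have e₁ := gval_flip I w₁.1 w₁.2.1 hI x v
  have e₂ := gval_flip I w₂.1 w₂.2.1 hI x v
  rw [h₁, hb₁] at e₁
  rw [h₂] at e₂
  by_cases hb₂ : gval I w₂.1 w₂.2.1 x = w₂.2.2
  · exact ht.2.2.2.2.2.2.1 ⟨x, hx, hb₁, hb₂⟩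
  · refine ht.2.2.2.2.2.2.1 ⟨_, hx', by rw [e₁]; cases w₁.2.2 <;> rfl, ?_⟩
    rw [e₂]; revert hb₂; cases gval I w₂.1 w₂.2.1 x <;> cases w₂.2.2 <;> decide

/-- **Direction `(1,1)`**: flipping `v` moves both readers — then `Γ₁ ⊕ Γ₂` misses `b₁ ⊕ b₂` (it equals its complement). -/
theorem failSum_of_dir11 (hI : I.IsPure xorAndPred) (ht : Terminal I r y J₀ w₁ w₂) (hc : c ∈ J₀) (hch : IsChord I J₀ c)
    (hvv : (I.vars c 2 = v ∧ I.vars c 3 = v') ∨ (I.vars c 2 = v' ∧ I.vars c 3 = v)) {x : Fin n → Bool} (hx : ∀ j ∈ J₀, I.eval x j = y j)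
    (h0 : x v' = false) (h₁ : mv I w₁.1 w₁.2.1 v x = true) (h₂ : mv I w₂.1 w₂.2.1 v x = true) :
    gval I (w₁.1 ∆ w₂.1) (w₁.2.1 ∆ w₂.2.1) x ≠ xor w₁.2.2 w₂.2.2 := by
  classical
  rw [gval_symmDiff]
  intro hsum
  have hx' := solves_update_priv hI hc hch hvv hx h0 (!x v)
  have e₁ := gval_flip I w₁.1 w₁.2.1 hI x v
  have e₂ := gval_flip I w₂.1 w₂.2.1 hI x v
  rw [h₁] at e₁
  rw [h₂] at e₂
  by_cases hb₁ : gval I w₁.1 w₁.2.1 x = w₁.2.2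
  · refine ht.2.2.2.2.2.2.1 ⟨x, hx, hb₁, ?_⟩
    rw [hb₁] at hsum; revert hsum; cases gval I w₂.1 w₂.2.1 x <;> cases w₁.2.2 <;> cases w₂.2.2 <;> decide
  · refine ht.2.2.2.2.2.2.1 ⟨_, hx', ?_, ?_⟩
    · rw [e₁]; revert hb₁; cases gval I w₁.1 w₁.2.1 x <;> cases w₁.2.2 <;> decide
    · rw [e₂]; revert hb₁ hsum; cases gval I w₁.1 w₁.2.1 x <;> cases gval I w₂.1 w₂.2.1 x <;> cases w₁.2.2 <;> cases w₂.2.2 <;> decide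

end Dir

/-! ## Restricted readers -/
section Restrict

variable {I : LocalMap 4 n m} {r : ℕ} {y : Fin m → Bool} {J₀ : Finset (Fin m)} {c : Fin m} {v v' z : Fin n} {𝒢 : Finset (Fin m)}

/-- Monotonicity of `avoid`. -/
theorem avoid_mono (I : LocalMap 4 n m) {G G' : Finset (Fin m)} (h : G ⊆ G') (z : Fin n) : avoid I G z ⊆ avoid I G' z := by
  intro g hg
  rw [mem_avoid] at hg ⊢
  exact ⟨h hg.1, hg.2⟩

/-- **RESTRICTED SLICE LEMMA.**  `c` a slice-generic chord (privates `v, v'`) for the menu `avoid 𝒢 z` of monomials not containing the outside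
variable `z`, this menu avoiding the privates of `c`; a reader `(C, G)`, `G ⊆ 𝒢`, missing `b` at every solution of the core with `x_{v'} = 0` and
`x_z = κ`.  Then `Γ|_{z := κ}` (`restrict1 C G z κ`) is chord-local at `c`. -/
theorem chordLocal_restrict_of_fail (hI : I.IsPure xorAndPred) (hS : SimpleOverlap I) (hc : c ∈ J₀) (hch : IsChord I J₀ c)
    (hvv : (I.vars c 2 = v ∧ I.vars c 3 = v') ∨ (I.vars c 2 = v' ∧ I.vars c 3 = v)) (hz : ∀ j ∈ J₀, z ∉ varSet I j)
    (hgen : SliceGeneric I y J₀ c (avoid I 𝒢 z))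
    (hmono : ∀ g ∈ avoid I 𝒢 z, (I.vars g 2 ≠ I.vars c 2 ∧ I.vars g 3 ≠ I.vars c 2) ∧ (I.vars g 2 ≠ I.vars c 3 ∧ I.vars g 3 ≠ I.vars c 3))
    {C : Finset (Fin n)} {G : Finset (Fin m)} (hG : G ⊆ 𝒢) (κ b : Bool)
    (hfail : ∀ x : Fin n → Bool, (∀ j ∈ J₀, I.eval x j = y j) → x v' = false → x z = κ → gval I C G x ≠ b) :
    ChordLocal I c (restrict1 I C G z κ).1 (restrict1 I C G z κ).2 := by
  classical
  obtain ⟨π', κ', hslice⟩ := exists_slice_priv (I := I) hvv false false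
  have hzv' : z ≠ v' := by
    intro e
    rcases hvv with ⟨-, h3⟩ | ⟨h2, -⟩
    · exact hz c hc (e ▸ h3 ▸ vars_mem_varSet I c 3)
    · exact hz c hc (e ▸ h2 ▸ vars_mem_varSet I c 2)
  have hsub : (restrict1 I C G z κ).2 ⊆ avoid I 𝒢 z := by
    intro g hg
    have hg' : g ∈ avoid I G z := by cases κ <;> exact hg
    exact avoid_mono I hG z hg'
  refine chordLocal_of_fail_slice hI hc hch hgen hmono hsub π' κ' (xor b (κ && decide (z ∈ C))) fun x hx hp hq => ?_
  · obtain ⟨-, hv'⟩ := hslice x hp hq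
    rw [gval_restrict1 I hI hS]
    have hsol := solves_update_of_outside hz hx κ
    have hne := hfail _ hsol (by rw [Function.update_of_ne hzv'.symm]; exact hv') (Function.update_self ..)
    revert hne
    cases gval I C G (Function.update x z κ) <;> cases b <;> cases (κ && decide (z ∈ C)) <;> decide

/-- **Two-local restricted readers are constant on the hyperplane**: if `Γ|_{z := κ}` is chord-local at two distinct chords (the first not parallel
to the second), then `Γ` takes the single value `κ ∧ [z ∈ C]` at every point with `x_z = κ`. -/
theorem const_on_hyperplane_of_two_chordLocal (hI : I.IsPure xorAndPred) (hS : SimpleOverlap I) {cᵢ cⱼ : Fin m} (hcᵢ : cᵢ ∈ J₀)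
    (hcⱼ : cⱼ ∈ J₀) (hne : cᵢ ≠ cⱼ) (hchᵢ : IsChord I J₀ cᵢ) (hv : ∃ s : Fin 4, s.val < 2 ∧ I.vars cᵢ s ∉ varSet I cⱼ)
    {C : Finset (Fin n)} {G : Finset (Fin m)} {κ : Bool} (hᵢ : ChordLocal I cᵢ (restrict1 I C G z κ).1 (restrict1 I C G z κ).2)
    (hⱼ : ChordLocal I cⱼ (restrict1 I C G z κ).1 (restrict1 I C G z κ).2) :
    ∀ x : Fin n → Bool, x z = κ → gval I C G x = (κ && decide (z ∈ C)) := by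
  classical
  intro x hxz
  have h := gval_eq_false_of_two_chordLocal hI hcᵢ hcⱼ hne hchᵢ hv hᵢ hⱼ x
  rw [gval_restrict1 I hI hS, show Function.update x z κ = x by rw [← hxz, Function.update_eq_self]] at h
  revert h
  cases gval I C G x <;> cases (κ && decide (z ∈ C)) <;> decide

/-- **Normal form along `z`**: `Γ(x) = Γ(x[z := κ]) ⊕ (x_z ⊕ κ) · mv_z(x)`. -/
theorem gval_eq_restrict_xor (hI : I.IsPure xorAndPred) (C : Finset (Fin n)) (G : Finset (Fin m)) (z : Fin n) (κ : Bool) (x : Fin n → Bool) :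
    gval I C G x = xor (gval I C G (Function.update x z κ)) (xor (x z) κ && mv I C G z x) := by
  classical
  have e₀ := gval_split_var I hI C G z x
  have e₁ := gval_split_var I hI C G z (Function.update x z κ)
  rw [Function.update_self, gval_update_of_forall_ne I x (notMem_erase z C) (avoid_spec I G z), mv_update_self I C G hI] at e₁
  rw [e₀, e₁]
  cases gval I (C.erase z) (avoid I G z) x <;> cases x z <;> cases κ <;> cases mv I C G z x <;> rfl

end Restrict

/-! ## Bi-chord-locality from a formula -/
section BiLocal

variable {I : LocalMap 4 n m} {J₀ : Finset (Fin m)} {cᵢ cⱼ : Fin m} {z : Fin n}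

/-- **A reader that is a function of the two chords' data and of one outside variable is bi-chord-local.** -/
theorem biChordLocal_of_formula (hz : ∀ j ∈ J₀, z ∉ varSet I j) {C : Finset (Fin n)} {G : Finset (Fin m)}
    (F : Bool → Bool → Bool → Bool → Bool → Bool → Bool → Bool)
    (h : ∀ x : Fin n → Bool, gval I C G x = F (xor (x (I.vars cᵢ 0)) (x (I.vars cᵢ 1))) (x (I.vars cᵢ 2)) (x (I.vars cᵢ 3))
      (xor (x (I.vars cⱼ 0)) (x (I.vars cⱼ 1))) (x (I.vars cⱼ 2)) (x (I.vars cⱼ 3)) (x z)) :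
    BiChordLocal I J₀ cᵢ cⱼ C G := by
  intro x x' hsᵢ hpᵢ hqᵢ hsⱼ hpⱼ hqⱼ hout
  rw [h x, h x', hsᵢ, hpᵢ, hqᵢ, hsⱼ, hpⱼ, hqⱼ, hout z hz]

end BiLocal

end Summit.PneNP.PneNP.Theorems.PstarChordReadHubLocal
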